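import Summits.BirchSwinnertonDyer.BirchSwinnertonDyer.Theorems.ClassRecordThreeDefs
import Summits.BirchSwinnertonDyer.BirchSwinnertonDyer.Theorems.ClassRecordThreeUnramifiedFixedByOpen
import Summits.BirchSwinnertonDyer.BirchSwinnertonDyer.Theses.ClassRecordThree
import Summits.BirchSwinnertonDyer.BirchSwinnertonDyer.Theses.KolyvaginRoadThree
import Summits.BirchSwinnertonDyer.Rank1Residual.X11b.Three.ValueReciprocityDictionary
import HarnessLib

/-!
# Routes `ClassRecordThree` ∕ `KolyvaginRoadThree`, crux `OpenValueReciprocityAtThree` (item stmt-BirchSwinnertonDyer-19281,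
# the SHARP K5-B child of `HsiehDescentAtThree`): the item from ARCHIMEDEAN K5-B —
# `Aut(ℂ/F)`-reciprocity of the normalized central values `L(f/K, χ, 1)/(π^{2n+1}·Ω^{4n})`

Cell `bsd-stepL` (run/shared/lean/pub/bsd-stepL/), seat `bsd-stepL-desc3-p1` (D-0074 hand; item of record 19281 after the
planner's split of 19108, ClassRecordThree rev 4 ∕ KolyvaginRoadThree rev 2), `--supports stmt-BirchSwinnertonDyer-19281`.

THE ITEM (`Theses.ClassRecordThree.OpenValueReciprocityAtThree` = `Theses.KolyvaginRoadThree.OpenValueReciprocityAtThree` =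
`∀ W, Theorems.ValueReciprocityBAtThree W`, bdp g10 p417714): for every datum `(W, ι′, K, 𝔭, κ, f)` of the `3 ∥ N` descent
(class X11b at 3, `Surj`, `d_K` ODD, Heegner `K`, `3` split, `𝔭 ∣ 3` matched to `ι′`, `κ` anticyclotomic) there are `Ω ≠ 0`
and `m ≥ 1`, `3 ∤ m`, with EXACT reciprocity `σ(bdpInterpolationValue 3 f 𝔭 χ n Ω) = bdpInterpolationValue 3 f 𝔭 (^σχ) n Ω`
for every `τ ∈ Aut(ℚ̄₃/ℚ₃)` fixing `μ_m`, every `σ ∈ Aut(ℂ/ℚ)` over `τ`, and every unramified `χ` of type `(n, −n)` through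
`κ`. It still speaks `3`-adically (`ι′`, `τ`, `κ`, avatars); the printed source ([T1] Bertolini–Darmon–Prasanna 2013
Thm. 5.5 ∕ (5.1.16) ∕ Prop. 1.12 (1) ∕ Lemma 5.3) speaks of COMPLEX central values and `Aut(ℂ/F)`, `F` a number field.

WHAT THIS FILE PROVES (glue, unconditional in itself):

* `openValueReciprocityAtThree_of_archimedeanReciprocity` — **ARCHIMEDEAN K5-B ⟹ item 19281**, where ARCHIMEDEAN K5-B is
  VERBATIM the body of the Literature named fact `bertoliniDarmonPrasanna2013_centralValue_reciprocity` (filed p419864,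
  review-queued at the time of writing, hence INLINED here as a hypothesis): for the newform `f` of `W` (`N = N_W`), `K`
  imaginary quadratic with `d_K` odd and every `q ∣ N` split: `∃ Ω ≠ 0`, `∃ F ⊂ ℂ` finite over `ℚ`, `F ⊇ K`, unramified
  above every odd prime split in `K`, with `σ(L(f/K,χ,1)/(π^{2n+1}Ω^{4n})) = L(f/K,^σχ,1)/(π^{2n+1}Ω^{4n})` for all
  `σ ∈ Aut(ℂ/F)` and all everywhere-unramified `χ` of type `(n, −n)`, `n ≥ 1`. PROOF: specialise the ramification clause
  at `ℓ = 3` (odd, split); T6-OPEN (`UnramifiedOpen.exists_level_forall_fixing_rootsOfUnity_apply_symm_eq`, p418539) gives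
  `m`, `3 ∤ m`, with every `τ` fixing `μ_m` fixing `ι′⁻¹(F)`, so `σ = ι′τι′⁻¹` fixes `F`; x11b3-p1's DICTIONARY
  (`Three.bdpInterpolationValue_exact_of_normalizedValue_exact`; `a_p ∈ ℤ` by `IsNewformOf`) transports exactness to
  `bdpInterpolationValue`. The binders `ClassX11b`, `Surj`, `𝔭`-matching, (Heeg) clause, `κ`, avatar are idle.
* `kolyvaginRoadThree_openValueReciprocityAtThree_of_archimedeanReciprocity` — the KolyvaginRoadThree copy (same Prop).
* `valueReciprocityBAtThree_of_archimedeanReciprocity` — the by-name form `∀ W, Theorems.ValueReciprocityBAtThree W`.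

HONEST FRAMING: CONDITIONAL glue. ARCHIMEDEAN K5-B is NOT discharged (it is a print-derived consequence of BDP13, filed as a
named fact for REVIEW); when p419864 lands, a two-line composition makes item 19281 conditional on exactly that ONE
Literature fact, as its sibling 19238 is on `TateSenCharacterVanishing 3`. Nothing booked (T7); no node touched.
What this is NOT: not K5-B itself; nothing at even `d_K`; nothing at `p ≥ 5`.

References: [BertoliniDarmonPrasanna2013] Prop. 1.12 (1) (p. 14), (4.1.3), Remark 4.3, Thm. 4.6, (5.1.11), Lemma 5.3,
Thm. 5.4, (5.1.15), Thm. 5.5, (5.1.16) (author version pp. 34–38, 56–60, held `paper:url-39cfb2a03b1d`); [Castella2018]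
Thm. 3.1; [Weil1956] §1; [SerreLocalFields1979] Ch. IV §4; cell files PROOF-BDP §18, x11b3 LIT-TABLE L72 ∕ L90.
-/

noncomputable section

open scoped NumberField
open NumberField IsDedekindDomain Field WeierstrassCurve
open Literature.NumberTheory.GaloisRepresentations Literature.NumberTheory.EllipticCurves
open Literature.NumberTheory.EllipticCurves.ModularForms
open Summit.BirchSwinnertonDyer.Rank1Residual Summit.BirchSwinnertonDyer.Rank1Residual.X11b
open Summit.BirchSwinnertonDyer.Rank1Residual.X11b.Three

namespace Summit.BirchSwinnertonDyer.BirchSwinnertonDyer.Theorems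

/-- **ARCHIMEDEAN K5-B ⟹ item 19281 `Theses.ClassRecordThree.OpenValueReciprocityAtThree` (SHARP K5-B).** Hypothesis = the
body of the named fact `Literature.NumberTheory.EllipticCurves.bertoliniDarmonPrasanna2013_centralValue_reciprocity`
VERBATIM (BDP13 Thm. 5.5 ∕ (5.1.16) ∕ Prop. 1.12 (1) ∕ Lemma 5.3 (3): `Aut(ℂ/F)`-reciprocity of
`L(f/K,χ,1)/(π^{2n+1}Ω^{4n})`, `F ⊇ K` finite, unramified above every odd prime split in `K`; `d_K` odd, every `q ∣ N`
split). Proof: the clause at `ℓ = 3`; T6-OPEN (`UnramifiedOpen.exists_level_forall_fixing_rootsOfUnity_apply_symm_eq`)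
turns «`σ` lies over a `τ` fixing `μ_m`» into «`σ` fixes `F`»; the dictionary
`Three.bdpInterpolationValue_exact_of_normalizedValue_exact` (`a_p ∈ ℤ`) finishes. Conditional glue; nothing discharged.
[cite: BertoliniDarmonPrasanna2013, Thm. 5.5 and (5.1.16) (p. 60)] [cite: Castella2018, Thm. 3.1 (arXiv:1704.06608 p. 9)]
[cite: SerreLocalFields1979, Ch. IV §4 Prop. 16 and Cor. 1] -/
theorem openValueReciprocityAtThree_of_archimedeanReciprocity
    (hArch : ∀ (W : WeierstrassCurve ℚ) [W.IsElliptic] (K : Type) [Field K] [NumberField K] {N : ℕ} [NeZero N]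
      (f : CuspForm (CongruenceSubgroup.Gamma0 N) 2),
      IsNewformOf W f → W.conductorNorm ℤ = N → IsImaginaryQuadratic K → Odd (NumberField.discr K) →
      SatisfiesHeegnerHypothesis N K →
      ∃ (Ω : ℂ) (F : IntermediateField ℚ ℂ), Ω ≠ 0 ∧ FiniteDimensional ℚ F ∧
        (∀ (φ : K →+* ℂ) (k : K), φ k ∈ F) ∧
        (∀ ℓ : ℕ, ℓ.Prime → ℓ ≠ 2 → ((Ideal.span {(ℓ : ℤ)}).primesOver (𝓞 K)).ncard = 2 →
          ∀ P : Ideal (𝓞 F), P.IsPrime → ((ℓ : ℕ) : 𝓞 F) ∈ P → P.ramificationIdx (𝓞 ℚ) = 1) ∧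
        ∀ σ : ℂ ≃ₐ[ℚ] ℂ, (∀ x : ℂ, x ∈ F → σ x = x) →
          ∀ (χ : HeckeCharacter K) (n : ℕ), 0 < n →
            (∀ v : HeightOneSpectrum (𝓞 K), χ.IsUnramifiedAt v) →
            ∀ hχ : χ.HasInfinityType (fun _ ↦ (n : ℤ)) (fun _ ↦ -(n : ℤ)),
              σ (rankinSelbergValueHecke f χ 1 / ((Real.pi : ℂ) ^ (2 * n + 1) * Ω ^ (4 * n))) =
                rankinSelbergValueHecke f (hχ.autConj σ) 1 / ((Real.pi : ℂ) ^ (2 * n + 1) * Ω ^ (4 * n))) :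
    Summit.BirchSwinnertonDyer.BirchSwinnertonDyer.Theses.ClassRecordThree.OpenValueReciprocityAtThree := by
  intro W _ _ ι' K _ _ 𝔭 κ N _ f hf _ _ hN hKiq hodd hHeeg hsplit _ _ _ _ _ _
  haveI : Fact (Nat.Prime 3) := ⟨Nat.prime_three⟩
  obtain ⟨Ω, F, hΩ, hFd, -, hunrF, hexact⟩ := hArch W K f hf hN hKiq hodd hHeeg
  have hunr3 : ∀ P : Ideal (𝓞 F), P.IsPrime → ((3 : ℕ) : 𝓞 F) ∈ P → P.ramificationIdx (𝓞 ℚ) = 1 :=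
    hunrF 3 Nat.prime_three (by decide) hsplit
  obtain ⟨m, hm, h3m, hfix⟩ :=
    UnramifiedOpen.exists_level_forall_fixing_rootsOfUnity_apply_symm_eq 3 ι' F hFd hunr3
  refine ⟨Ω, hΩ, m, hm, h3m, fun τ σ hτ hστ χ n hn hunrχ hχ _ _ _ ↦ ?_⟩
  have hσF : ∀ x : ℂ, x ∈ F → σ x = x := fun x hx ↦ by
    have h := hστ (ι'.symm x)
    rwa [ι'.apply_symm_apply, hfix τ hτ x hx, ι'.apply_symm_apply] at h
  exact bdpInterpolationValue_exact_of_normalizedValue_exact 3 (exists_int_cuspCoeff_eq_of_isNewformOf hf 3) 𝔭 hχ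
    n Ω σ (hexact σ hσF χ n hn hunrχ hχ)

/-- **The KolyvaginRoadThree copy of item 19281 from ARCHIMEDEAN K5-B** (`Theses.KolyvaginRoadThree.OpenValueReciprocityAtThree`
is the same proposition as the ClassRecordThree decl; shared item). Conditional glue; nothing discharged.
[cite: BertoliniDarmonPrasanna2013, Thm. 5.5 and (5.1.16) (p. 60)] -/
theorem kolyvaginRoadThree_openValueReciprocityAtThree_of_archimedeanReciprocity
    (hArch : ∀ (W : WeierstrassCurve ℚ) [W.IsElliptic] (K : Type) [Field K] [NumberField K] {N : ℕ} [NeZero N]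
      (f : CuspForm (CongruenceSubgroup.Gamma0 N) 2),
      IsNewformOf W f → W.conductorNorm ℤ = N → IsImaginaryQuadratic K → Odd (NumberField.discr K) →
      SatisfiesHeegnerHypothesis N K →
      ∃ (Ω : ℂ) (F : IntermediateField ℚ ℂ), Ω ≠ 0 ∧ FiniteDimensional ℚ F ∧
        (∀ (φ : K →+* ℂ) (k : K), φ k ∈ F) ∧
        (∀ ℓ : ℕ, ℓ.Prime → ℓ ≠ 2 → ((Ideal.span {(ℓ : ℤ)}).primesOver (𝓞 K)).ncard = 2 →
          ∀ P : Ideal (𝓞 F), P.IsPrime → ((ℓ : ℕ) : 𝓞 F) ∈ P → P.ramificationIdx (𝓞 ℚ) = 1) ∧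
        ∀ σ : ℂ ≃ₐ[ℚ] ℂ, (∀ x : ℂ, x ∈ F → σ x = x) →
          ∀ (χ : HeckeCharacter K) (n : ℕ), 0 < n →
            (∀ v : HeightOneSpectrum (𝓞 K), χ.IsUnramifiedAt v) →
            ∀ hχ : χ.HasInfinityType (fun _ ↦ (n : ℤ)) (fun _ ↦ -(n : ℤ)),
              σ (rankinSelbergValueHecke f χ 1 / ((Real.pi : ℂ) ^ (2 * n + 1) * Ω ^ (4 * n))) =
                rankinSelbergValueHecke f (hχ.autConj σ) 1 / ((Real.pi : ℂ) ^ (2 * n + 1) * Ω ^ (4 * n))) :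
    Summit.BirchSwinnertonDyer.BirchSwinnertonDyer.Theses.KolyvaginRoadThree.OpenValueReciprocityAtThree :=
  openValueReciprocityAtThree_of_archimedeanReciprocity hArch

/-- **By name: `∀ W, Theorems.ValueReciprocityBAtThree W` (bdp g10's def, p417714) from ARCHIMEDEAN K5-B** — the same
proposition as item 19281, in the route-importable currency. Conditional glue; nothing discharged.
[cite: BertoliniDarmonPrasanna2013, Thm. 5.5 and (5.1.16) (p. 60)] -/
theorem valueReciprocityBAtThree_of_archimedeanReciprocity
    (hArch : ∀ (W : WeierstrassCurve ℚ) [W.IsElliptic] (K : Type) [Field K] [NumberField K] {N : ℕ} [NeZero N]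
      (f : CuspForm (CongruenceSubgroup.Gamma0 N) 2),
      IsNewformOf W f → W.conductorNorm ℤ = N → IsImaginaryQuadratic K → Odd (NumberField.discr K) →
      SatisfiesHeegnerHypothesis N K →
      ∃ (Ω : ℂ) (F : IntermediateField ℚ ℂ), Ω ≠ 0 ∧ FiniteDimensional ℚ F ∧
        (∀ (φ : K →+* ℂ) (k : K), φ k ∈ F) ∧
        (∀ ℓ : ℕ, ℓ.Prime → ℓ ≠ 2 → ((Ideal.span {(ℓ : ℤ)}).primesOver (𝓞 K)).ncard = 2 →
          ∀ P : Ideal (𝓞 F), P.IsPrime → ((ℓ : ℕ) : 𝓞 F) ∈ P → P.ramificationIdx (𝓞 ℚ) = 1) ∧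
        ∀ σ : ℂ ≃ₐ[ℚ] ℂ, (∀ x : ℂ, x ∈ F → σ x = x) →
          ∀ (χ : HeckeCharacter K) (n : ℕ), 0 < n →
            (∀ v : HeightOneSpectrum (𝓞 K), χ.IsUnramifiedAt v) →
            ∀ hχ : χ.HasInfinityType (fun _ ↦ (n : ℤ)) (fun _ ↦ -(n : ℤ)),
              σ (rankinSelbergValueHecke f χ 1 / ((Real.pi : ℂ) ^ (2 * n + 1) * Ω ^ (4 * n))) =
                rankinSelbergValueHecke f (hχ.autConj σ) 1 / ((Real.pi : ℂ) ^ (2 * n + 1) * Ω ^ (4 * n))) :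
    ∀ (W : WeierstrassCurve ℚ) [W.IsElliptic] [W.IsGloballyMinimal], ValueReciprocityBAtThree W :=
  openValueReciprocityAtThree_of_archimedeanReciprocity hArch

end Summit.BirchSwinnertonDyer.BirchSwinnertonDyer.Theorems

end
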